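import Summits.BirchSwinnertonDyer.BirchSwinnertonDyer.Theses.ErratumRoadFive
import HarnessLib

/-!
# crux idea `parity-rekey-rq` (stmt-BirchSwinnertonDyer-19715, `EulerHalfNotRamNoInertSetAtFive`) — Sketch, rev 1.0

bsd-idea-9 g64 (planner-bsd-idea-9-g64-0), 2026-08-31. Lens = complete. NO skeleton, NO stubs, NO sorry;
nothing here proves BSD, crux 19715 or any summit statement — this seat proves no summit statement.

THE DOOR (informal; the card `Ideas/parity-rekey-rq.md` has the mechanism and the cruxes K1–K3). Over `ℚ` the
route's inert Shimura re-key (`…SixItemsFrobenius.lean`) needs an inert set `S ∋ p` of EVEN cardinality made of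
multiplicative primes; on 19715's locus (334 pairs with `p` the ONLY multiplicative prime, 70 with exactly
three) no such `S` exists — a parity obstruction (`B_{p,∞}` is definite). Base-change `E` to a real quadratic
field `F = ℚ(√d)`, `d > 0` squarefree, `gcd(d, N_E) = 1`, `(d/p) = -1`: the quaternion algebra `B/F` ramified at
`{𝔭 = p𝒪_F, ∞₂}` EXISTS (two places) and is split at `∞₁`, so it carries a Shimura curve `X_B/F` and an optimal
quotient `ξ : J_B → E₁ ~ E_F` with `𝔭 ∈ Ram(B)` — the second REAL place `∞₂` is the parity partner that `p` lacks
over `ℚ`. At the Čerednik–Varshavsky prime `𝔭` the lattice identity (card, (♠); SGA7 IX adjunction + unimodularity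
of the Brandt pairing of the totally definite `B̄ = B_{∞₁∞₂}`)
`ord_p ⟨φ^{B̄}, φ^{B̄}⟩ = ord_p c_𝔭 + ord_p deg ξ − 2·ord_p m`, `|coker(Φ_𝔭(J_B) → Φ_𝔭(E₁))| = gcd(m, c_𝔭)`,
turns «`c_p` is absorbed by the Shimura degree» into crux K1a «`p ∤ m`: the component group of `J_B` at `𝔭`
SURJECTS onto `Φ_𝔭(E₁)[p^∞] ≅ ℤ/p^{ord_p c_p}`» (over `ℚ`: true at Čerednik primes = Ribet–Takahashi ⇔ Pasten
L6.15/6.18, false at Deligne–Rapoport primes of `X₀(N)` by Edixhoven's Eisenstein theorem); with K1b (Gross period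
of the base change on `B̄` bounded by the Petersson/Néron congruence number — Tilouine–Urban type, at `p ∥ N`),
CM points by a quartic CM field `K ⊃ F` with `𝔭` inert in `K/F`, the explicit Gross–Zagier formula over `F`
(Cai–Shu–Tian Thm. 1.5, special case 1) and a Kolyvagin-sharp order bound over `K` (K3), the index bookkeeping on
the 334 one-prime pairs reads `2·m₀ = ord_p #Ш(E/K)_an` — BSD-sharp, no Tamagawa loss, nothing `p`-adic at `p`.
After isolating the `F`-twist `E_F ⊗ χ_{K/F}` (a `p`-unit choice of `K`, crux K2) the door's OUTPUT is the joint
upper bound below for the pair `(E, E^{(d)})`, i.e. the Euler-system half of `p`-BSD for `E` over `F`; the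
route's OWN binder `X11aLowerHalf` (item 19064: the twist `E^{(d)}` is a rank-0, non-split-multiplicative-at-`p`,
irreducible, `¬(ram)` pair = ClassX11a) then isolates `E`. The two theorems are the bookkeeping of that last
step, kernel-checked.
-/

noncomputable section

open scoped Classical

set_option autoImplicit false

open WeierstrassCurve Literature.NumberTheory.EllipticCurves
open Literature.NumberTheory.EllipticCurves.Rank1Residual
open Summit.BirchSwinnertonDyer.Rank1Residual
open Summit.BirchSwinnertonDyer.BirchSwinnertonDyer.Theses.ErratumRoadFive

namespace Summit.BirchSwinnertonDyer.BirchSwinnertonDyer.Cruxes.EulerHalfNotRamNoInertSetAtFive.ParityRekeyRQ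

/-- **The door's output at `(W, p)` — the real-quadratic upper pair.** There is a positive integer `d`
with `d` a non-square unit mod `p` (so `p` is inert in `F = ℚ(√d)`), a globally minimal model `Wd` of the
twist `W^{(d)}` which is a ClassX11a pair at `p` (rank `0`, `p` odd multiplicative — non-split, since `p` is
inert —, `E[p]` irreducible, no (ram) witness), and rationals `qE = #Ш(E)_an`, `qd = #Ш(E^{(d)})_an` with the
JOINT Euler-system inequality `ord_p #Ш(E) + ord_p #Ш(E^{(d)}) ≤ ord_p qE + ord_p qd` — which is the
`p`-part upper bound for `E` over `F` (`Ш(E/F)[p^∞] = Ш(E)[p^∞] ⊕ Ш(E^{(d)})[p^∞]`, `#Ш(E/F)_an = qE·qd`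
up to `p`-units, `p` odd unramified in `F`). A predicate; NOTHING asserted. [folklore] -/
def RealQuadraticUpperPairAt (W : WeierstrassCurve ℚ) (p : ℕ) [Fact p.Prime] : Prop :=
  ∃ (d : ℤ) (Wd : WeierstrassCurve ℚ) (_ : Wd.IsElliptic) (_ : Wd.IsGloballyMinimal),
    0 < d ∧ ¬ IsSquare ((d : ZMod p)) ∧ (d : ZMod p) ≠ 0 ∧
    (∃ C : VariableChange ℚ, C • W.quadraticTwist (d : ℚ) = Wd) ∧
    ClassX11a Wd p ∧
    ∃ qE qd : ℚ, shaAn W = (qE : ℂ) ∧ shaAn Wd = (qd : ℂ) ∧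
      (padicValNat p W.shaOrder : ℤ) + padicValNat p Wd.shaOrder ≤ padicValRat p qE + padicValRat p qd

/-- **Isolation (First lemma, proved).** The door's output at `(W, p)` plus the route's own binder
`X11aLowerHalf` (item 19064, consumed by `closes` already) give the crux's conclusion
`Typed.MissingUpperBoundAt W p`: the twist's `≥`-half cancels the twist. Pure bookkeeping over the
uniqueness of the rational `#Ш_an`. [folklore] -/
theorem missingUpperBoundAt_of_realQuadraticUpperPair (W : WeierstrassCurve ℚ) (p : ℕ) [Fact p.Prime]
    (h : RealQuadraticUpperPairAt W p) (hX : X11aLowerHalf) : Typed.MissingUpperBoundAt W p := by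
  obtain ⟨d, Wd, hWdE, hWdM, _hd, _hns, _hnz, _hC, hX11a, qE, qd, hqE, hqd, hle⟩ := h
  obtain ⟨q', hq', hlow⟩ := hX Wd p hX11a
  have hqq : q' = qd := by exact_mod_cast hq'.symm.trans hqd
  subst hqq
  exact ⟨qE, hqE, by omega⟩

/-- **The door, by name.** If every pair on crux 19715's locus (here weakened to: every globally minimal
`W` and prime `p ≥ 5` with `ClassX11b W p`, `Surj`, `¬ Ram`, `p ∣ ∏ c_ℓ`) carries a real-quadratic upper
pair, then `X11aLowerHalf → EulerHalfNotRamNoInertSetAtFive` — the inert-set exclusion hypothesis of the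
crux is simply not used (the door does not need an inert set over `ℚ`). [folklore] -/
theorem eulerHalfNotRamNoInertSetAtFive_of_realQuadraticUpperPairs
    (hdoor : ∀ (W : WeierstrassCurve ℚ) [W.IsElliptic] [W.IsGloballyMinimal] (p : ℕ) [Fact p.Prime],
      ClassX11b W p → 5 ≤ p → Surj W p → ¬ Ram W p → p ∣ W.tamagawaProduct →
      RealQuadraticUpperPairAt W p)
    (hX : X11aLowerHalf) : EulerHalfNotRamNoInertSetAtFive := by
  intro W _ _ p _ hcls h5 hsurj hram hdvd _hnoInert
  exact missingUpperBoundAt_of_realQuadraticUpperPair W p (hdoor W p hcls h5 hsurj hram hdvd) hX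

end Summit.BirchSwinnertonDyer.BirchSwinnertonDyer.Cruxes.EulerHalfNotRamNoInertSetAtFive.ParityRekeyRQ

end
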